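import Summits.HubbardSuperconductivity.HubbardSuperconductivity.Theorems.KkFloorLiftToSummit
import Literature.MathematicalPhysics.QuantumLattice.FinDimSpectrumSectorGibbsLimit
import Literature.Barriers.HubbardSuperconductivity.HohenbergMerminWagnerPairing
import Summits.HubbardSuperconductivity.HubbardSuperconductivity.Theorems.KkBandLift.Negative.ThermalShellOfStubs

/-!
# CERTIFICATE (refuter-b2b-kkfloor-2-g2-0, 2026-08-18; re-checked and written to the crux directory by
refuter-b2b-kkfloor-1-g3-0: rc 0, 0 sorry, `#print axioms not_kkBandLift` = propext, Classical.choice,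
Quot.sound): the strategist's skeleton with ZERO `sorry`

This is `Cruxes/KkBandLift/StrategistNegation.lean` VERBATIM except that (i) one import is added
(`Theorems.KkBandLift.Negative.ThermalShellOfStubs`) and (ii) the four `stub_*` proofs `by sorry` are
replaced by the landed extractions:
N1 `stub_finiteXFloor := Negative.finiteXFloor` (p175298),
N3 `stub_gibbsShellSelection := Negative.gibbsShellSelection` (p175319),
N4 `stub_sectorPairDecay := Negative.sectorPairDecay` (p175521),
bookkeeping `stub_thermalShellWitness_of := Negative.thermalShellWitness_of_stubs` (p175571).
Every statement (the `def … : Prop` bodies and theorem types) is UNCHANGED, so `lean check` rc 0 with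
0 sorries certifies that `not_kkBandLift_of_stubs` / `not_kkBandLift` are discharged by tree theorems
along the strategist's own line. HONEST FRAMING: a certificate / theorem, NOT summit progress — the
verdict `¬ KkBandLift` is booked as `Theorems.KkFloorKkBandLift_refuted` (p175351).
-/

/-!
# Crux `KkBandLift` (stmt-HubbardSuperconductivity-10402, route `KkFloor`) — NEGATION skeleton
# "thermal shell": the band lift contradicts Hohenberg–Mermin–Wagner at low energy density

Crux-strategist workfile (planner `planner-cstrat-stmt-HubbardSuperconductivity-10402-r1-0`,
2026-08-17). `sorry` only inside `stub_*`; the composition `not_kkBandLift_of` is kernel-checked.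

## The argument (all of it finite-dimensional; every ingredient is in the tree or one step from it)

Notation at side `L`: `H = hubbardTorus 2 L 1 U`, `Π = L⁻² Δ_dᴴ Δ_d`, `V = szSector N_L 0`,
`E₀ = minEnergyOn H V`, `a(z) = min Re spec((H + zΠ)|_V)`.

* (N1, `FiniteXFloor`, stub) **Kramers–Kronig floor at finite height `x > 0`.** `a - E₀` is
  superharmonic (Vesentini, tree: `isSubharmonicOn_log_spectralRadius_exp_pencil`) and `≥ 0` on
  `Re z ≥ 0` (numerical range), hence minorised on the right half-plane by the Poisson integral of
  its imaginary-axis trace: `π (a(x) - E₀) ≥ ∫ (a(iy) - E₀) x (x² + y²)⁻¹ dy` — this is LITERALLY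
  `stepA` inside the proof of `Literature.Analysis.Potential.lintegral_boundary_le_of_subharmonic`
  (the route's proved `KkFloorTheorem` is its `x → 0⁺` limit). With Rayleigh–Ritz
  `a(x) ≤ ⟨φ, (H + xΠ) φ⟩` for every unit `φ ∈ V` this gives, for ANY profile `d ≤ a(i·) - E₀` on `S`:
  `∫_S d(y) x/(x²+y²) dy ≤ π ((⟨φ,Hφ⟩ - E₀) + x ⟨φ,Πφ⟩)`.
* (N2) `KkBandLift` feeds `d ≡ ε L²` on `S = [Y₁, Y₂]`, so at `x = 1`:
  `ε L² (Y₂ - Y₁)/(1 + Y₂²) ≤ π ((⟨φ,Hφ⟩ - E₀) + L⁻² ⟨φ, Δ_dᴴΔ_d φ⟩)` for EVERY unit `φ ∈ V` —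
  i.e. the band lift forces `d`-wave pair long-range order on every sector state of energy density
  `< ε (Y₂ - Y₁)/(2π(1 + Y₂²))` above the ground energy ("low-energy LRO"), not only on ground states.
* (N3, `GibbsShellSelection`, stub; folklore) for the sector Gibbs weights `p_j ∝ e^{-βE_j}` on an
  `H`-eigenbasis of `V`: the eigenstates with `E_j - E₀ > 2 log(2 dim)/β` carry weight `≤ 1/4`, so
  some eigenstate has BOTH `E_j ≤ E₀ + 2 log(2 dim)/β ≤ E₀ + 3 L² /β` AND
  `⟨j, A j⟩ ≤ 2 ⟨A⟩_{β,V}` for any `A` with nonnegative form (Markov twice).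
* (N4, `SectorPairDecay`, stub) **Koma–Tasaki 1992 in the canonical sector**: at every fixed
  `β < ∞`, `|⟨(P_x)ᴴ P_y⟩_{β,V}| ≤ C (dist(x,y) + 1)^{-f}`, `f = f(β) > 0`, uniformly in `L` and in
  the sector — the tree PROVES the grand-canonical version for the summit's pair field
  (`Literature.Barriers.HubbardSuperconductivity.norm_thermalCorr_localPair_le`, from the
  model-independent `norm_gibbsState_le_of_gauge`); the McBryan–Spencer gauge `siteGauge φ` is
  diagonal in the occupation basis, so it, `H`, the hopping perturbation and `(P_x)ᴴ P_y` all
  preserve `V` and the same trace bound holds with `tr` replaced by `tr (P_V ·)` (KT p. 2: "Our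
  result is independent of ρ and thus applies to grand canonical averages as well" — their proof
  is written at fixed density). Summing, `⟨Δ_dᴴ Δ_d⟩_{β,V} ≤ C' L^{4-f} = o(L⁴)`.
* (N3 + N4 ⇒ `ThermalShellWitness`, stub `stub_thermalShellWitness_of`, bookkeeping): for every
  `c > 0`, choosing `β = 3/c` and then `L` large, there is a unit `φ ∈ V` with
  `⟨φ,Hφ⟩ ≤ E₀ + c L²` and `⟨φ, Δ_dᴴ Δ_d φ⟩ ≤ c L⁴`.
* `not_kkBandLift_of` (PROVED below): N1 ∧ ThermalShellWitness ⇒ `¬ KkBandLift` (take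
  `c = ε (Y₂ - Y₁)/(4π(1 + Y₂²))` and an even side `L ≥ L₀, L₁`).

Hence `KkBandLift` is false at EVERY `(U, δ, ε, Y₁, Y₂)`: the route's own kill criterion (i)
("universal softness": the measurement lift `a_L(iy) - E₀(L)` is `o(L²)` in Poisson average at
every coupling and doping). Physically: in `d = 2` pair order can be destroyed at arbitrarily small
ENERGY DENSITY (thermal phase fluctuations, Hohenberg–Mermin–Wagner / Koma–Tasaki), while the band
lift + the finite-`x` floor would make pair order cost-protected at positive energy density. The
barrier the route header marked "not met — T = 0 only" (`PositiveTemperatureNoPairLRO`,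
`HohenbergMerminWagnerPairing`) is met one Poisson kernel away from the imaginary axis.

Sources: T. Ransford, *Potential Theory in the Complex Plane* (1995) §2.3–2.4, Thm 6.4.2
[doi:10.1017/cbo9780511623776]; T. Koma, H. Tasaki, PRL 68 (1992) 3248 (`KomaTasakiPRL1992`,
Theorem (2), p. 2–3, footnote [10]); H. Tasaki, *Physics and Mathematics of Quantum Many-Body
Systems* (2020) App. A (`Tasaki2020`).
-/

set_option linter.dupNamespace false

noncomputable section

namespace Summit.HubbardSuperconductivity.HubbardSuperconductivity.Cruxes.KkBandLift.ThermalShell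

open Matrix MeasureTheory
open Literature.MathematicalPhysics.QuantumLattice Literature.Probability.LatticeModels
open Summit.HubbardSuperconductivity.TwTipContinuation.Negative (expect_pairIntensity_nonneg)
open Summit.HubbardSuperconductivity.HubbardSuperconductivity.Theses.KkFloor (KkBandLift)
open scoped ComplexOrder

/-! ### N1 — the Kramers–Kronig floor at finite height (potential theory, no physics) -/

/-- **N1 `FiniteXFloor`.** For Hermitian `A`, Hermitian `B` with nonnegative form, a subspace `V`
invariant under both, a real `E` below the Rayleigh quotient of `A` on unit vectors of `V`, a height
`x > 0`, a set `S ⊆ ℝ` and ANY profile `d` with `E + d(y) ≤ Re λ` for every eigenpair `(λ, v)`,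
`v ∈ V ∖ 0`, of `A + iyB`, `y ∈ S`: for every unit `φ ∈ V`,
`∫⁻_S d(y) · x/(x²+y²) dy ≤ π ((Re⟨φ,Aφ⟩ - E) + x Re⟨φ,Bφ⟩)`.
(Poisson minorisation of the nonnegative superharmonic `a - E` on `Re z > 0` at the point `x`,
= `stepA` of `Literature.Analysis.Potential.lintegral_boundary_le_of_subharmonic`, then
Rayleigh–Ritz `a(x) ≤ ⟨φ,(A + xB)φ⟩`; no ground state and no `V ≠ ⊥` needed.) Size M: extract
`stepA` as a lemma with the one-point hypothesis `-γ ≤ u x`, and rerun the coordinate reduction of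
`kkFloorTheorem_proof`. [cite: doi:10.1017/cbo9780511623776, §2.4 and Thm 6.4.2] -/
def FiniteXFloor : Prop :=
  ∀ (n : Type) [Fintype n] [DecidableEq n] (A B : Matrix n n ℂ) (V : Submodule ℂ (n → ℂ)) (E x : ℝ)
    (S : Set ℝ) (d : ℝ → ℝ), A.IsHermitian → B.IsHermitian →
    (∀ v : n → ℂ, 0 ≤ (star v ⬝ᵥ B *ᵥ v).re) → (∀ v ∈ V, A *ᵥ v ∈ V) → (∀ v ∈ V, B *ᵥ v ∈ V) →
    (∀ v ∈ V, star v ⬝ᵥ v = 1 → E ≤ (star v ⬝ᵥ A *ᵥ v).re) → 0 < x →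
    (∀ y ∈ S, ∀ v ∈ V, v ≠ 0 → ∀ lam : ℂ,
      (A + (Complex.I * (y : ℂ)) • B) *ᵥ v = lam • v → E + d y ≤ lam.re) →
    ∀ φ ∈ V, star φ ⬝ᵥ φ = 1 →
      ∫⁻ y in S, ENNReal.ofReal (d y * (x / (x ^ 2 + y ^ 2))) ≤
        ENNReal.ofReal (Real.pi * (((star φ ⬝ᵥ A *ᵥ φ).re - E) + x * (star φ ⬝ᵥ B *ᵥ φ).re))

/-- stub N1 (potential theory; M). -/
theorem stub_finiteXFloor : FiniteXFloor :=
  Theorems.KkBandLift.Negative.finiteXFloor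

/-! ### N3/N4 — the thermal shell: low energy density without pair order (Koma–Tasaki 1992) -/

/-- The canonical (sector) Gibbs average `tr (P_K e^{-βH} A) / tr (P_K e^{-βH})` of the tree
(`FinDimSpectrumSectorGibbsLimit`, same expression), named locally for readability. [folklore] -/
def sectorGibbsAvg {n : Type*} [Fintype n] [DecidableEq n] (H : Matrix n n ℂ)
    (K : Submodule ℂ (n → ℂ)) (β : ℝ) (A : Matrix n n ℂ) : ℂ :=
  (projMatrix (K.map ((WithLp.linearEquiv 2 ℂ (n → ℂ)).symm :
      (n → ℂ) →ₗ[ℂ] EuclideanSpace ℂ n)) * gibbsWeight β H * A).trace /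
    (projMatrix (K.map ((WithLp.linearEquiv 2 ℂ (n → ℂ)).symm :
      (n → ℂ) →ₗ[ℂ] EuclideanSpace ℂ n)) * gibbsWeight β H).trace

/-- **N3 `GibbsShellSelection`** (folklore linear algebra; M). For Hermitian `H`, an `H`-invariant
`K ≠ ⊥`, `A` with nonnegative form and `β > 0`: some unit `φ ∈ K` (an `H`-eigenvector, in fact)
has energy `≤ minEnergyOn H K + 2 log(2·card n)/β` and `Re⟨φ,Aφ⟩ ≤ 2 |⟨A⟩_{β,K}|` (the Gibbs
weight above that energy is `≤ 1/4`; Markov on the rest). [cite: Tasaki2020, App. A] -/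
def GibbsShellSelection : Prop :=
  ∀ (n : Type) [Fintype n] [DecidableEq n] (H A : Matrix n n ℂ) (K : Submodule ℂ (n → ℂ)) (β : ℝ),
    H.IsHermitian → (∀ v ∈ K, H *ᵥ v ∈ K) → (∀ v : n → ℂ, 0 ≤ (star v ⬝ᵥ A *ᵥ v).re) → K ≠ ⊥ →
    0 < β →
    ∃ φ ∈ K, star φ ⬝ᵥ φ = 1 ∧
      (star φ ⬝ᵥ H *ᵥ φ).re ≤ H.minEnergyOn K + 2 * Real.log (2 * Fintype.card n) / β ∧
      (star φ ⬝ᵥ A *ᵥ φ).re ≤ 2 * ‖sectorGibbsAvg H K β A‖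

/-- stub N3 (folklore; M). -/
theorem stub_gibbsShellSelection : GibbsShellSelection :=
  Theorems.KkBandLift.Negative.gibbsShellSelection

/-- **N4 `SectorPairDecay`** — Koma–Tasaki's power-law bound for the summit's `d`-wave local pair
field in the CANONICAL `(N, S^z) = (2m, 0)` sectors of the pure torus `hubbardTorus 2 L 1 U`,
uniformly in `L` and `m`: `|⟨(P_x)ᴴ P_y⟩_{β,V}| ≤ C (dist(x,y)+1)^{-f}`, `f > 0` depending on `β`
only. The grand-canonical statement is the tree's
`Literature.Barriers.HubbardSuperconductivity.norm_thermalCorr_localPair_le`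
(`C = pairFieldDecayConst dWaveFormFactor`, `f = pairDecayExponent β`); the sector version is the
same McBryan–Spencer computation with `tr ↦ tr (P_V ·)`, every operator involved preserving `V`
(M/L: compress `norm_gibbsState_le_of_gauge` to an invariant coordinate subspace).
[cite: KomaTasakiPRL1992, Theorem (2), p. 2 ("independent of ρ") and footnote [10]] -/
def SectorPairDecay : Prop :=
  ∀ (U β : ℝ), 0 < β → ∃ C f : ℝ, 0 < f ∧ ∀ (L : ℕ) [NeZero L] (m : ℕ) (x y : TorusSite 2 L),
    ‖sectorGibbsAvg (hubbardTorus 2 L 1 U) (szSector (Λ := FermionTorus 2 L) (2 * m) 0) β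
        ((localPair dWaveFormFactor L x)ᴴ * localPair dWaveFormFactor L y)‖ ≤
      C * ((torusDist x y : ℝ) + 1) ^ (-f)

/-- stub N4 (Koma–Tasaki in the sector; M/L). -/
theorem stub_sectorPairDecay : SectorPairDecay :=
  Theorems.KkBandLift.Negative.sectorPairDecay

/-- **`ThermalShellWitness U δ`** — the soft-phase witness consumed by the refutation: at every
positive energy density above the sector ground energy there are sector states WITHOUT `d`-wave
pair order: `∀ c > 0, ∃ L₁, ∀ L ≥ L₁, ∃ unit φ ∈ V_L` with `Re⟨φ,H_Lφ⟩ ≤ E₀(L) + cL²` and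
`Re⟨φ, Δ_dᴴΔ_d φ⟩ ≤ c L⁴`. (= ¬ "low-energy LRO"; from N3 + N4 with `β = 3/c`,
`2 log(2·4^{L²})/β ≤ c L²`, and `Σ_{x,y} C(dist+1)^{-f} = o(L⁴)` by the tree's
`tendsto_normalizedSum_zero_of_abs_le_rpow`.) [cite: KomaTasakiPRL1992, p. 3] -/
def ThermalShellWitness (U δ : ℝ) : Prop :=
  ∀ c : ℝ, 0 < c → ∃ L₁ : ℕ, ∀ (L : ℕ) [NeZero L], L₁ ≤ L →
    ∃ φ : Fock (Orb (FermionTorus 2 L)),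
      φ ∈ szSector (Λ := FermionTorus 2 L) (2 * ⌊(1 - δ) * (L : ℝ) ^ 2 / 2⌋₊) 0 ∧
      star φ ⬝ᵥ φ = 1 ∧
      (star φ ⬝ᵥ hubbardTorus 2 L 1 U *ᵥ φ).re ≤
        (hubbardTorus 2 L 1 U).minEnergyOn
          (szSector (Λ := FermionTorus 2 L) (2 * ⌊(1 - δ) * (L : ℝ) ^ 2 / 2⌋₊) 0) + c * (L : ℝ) ^ 2 ∧
      (star φ ⬝ᵥ ((pairField dWaveFormFactor L)ᴴ * pairField dWaveFormFactor L) *ᵥ φ).re ≤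
        c * (L : ℝ) ^ 4

/-- stub (bookkeeping; M): N3 + N4 ⇒ the witness at every `U` and every doping `δ ∈ (0, ½)`
(the doping range keeps the sector `≠ ⊥`: `N↑ = N↓ = ⌊(1-δ)L²/2⌋ ≤ L²`; for `δ < -1` the sector is
empty and the witness would be false). -/
theorem stub_thermalShellWitness_of (h3 : GibbsShellSelection) (h4 : SectorPairDecay) :
    ∀ U δ : ℝ, δ ∈ Set.Ioo (0 : ℝ) (1 / 2) → ThermalShellWitness U δ :=
  Theorems.KkBandLift.Negative.thermalShellWitness_of_stubs h3 h4

/-! ### The refutation: N1 ∧ witness ⇒ ¬ KkBandLift (kernel-checked) -/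

/-- One side: the band lift at side `L` and the finite-height floor give, for every unit sector
state `φ`, `ε L² (Y₂ - Y₁)/(1 + Y₂²) ≤ π ((Re⟨φ,Hφ⟩ - E₀) + L⁻² Re⟨φ, Δ_dᴴΔ_d φ⟩)`. [folklore] -/
theorem lowEnergy_pairOrder_of_band (hF : FiniteXFloor)
    (L : ℕ) [NeZero L] (U : ℝ) (N2 : ℕ) {ε Y₁ Y₂ : ℝ} (hε : 0 < ε) (hY₁ : 0 < Y₁) (hY₁₂ : Y₁ < Y₂)
    (hband : ∀ y ∈ Set.Icc Y₁ Y₂, ∀ φ : Fock (Orb (FermionTorus 2 L)),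
      φ ∈ szSector (Λ := FermionTorus 2 L) (2 * N2) 0 → φ ≠ 0 → ∀ lam : ℂ,
        (hubbardTorus 2 L 1 U + (Complex.I * (y : ℂ)) • ((((1 : ℝ) / (L : ℝ) ^ 2 : ℝ) : ℂ) •
          ((pairField dWaveFormFactor L)ᴴ * pairField dWaveFormFactor L))) *ᵥ φ = lam • φ →
        (hubbardTorus 2 L 1 U).minEnergyOn (szSector (Λ := FermionTorus 2 L) (2 * N2) 0) +
          ε * (L : ℝ) ^ 2 ≤ lam.re)
    {φ : Fock (Orb (FermionTorus 2 L))} (hφV : φ ∈ szSector (Λ := FermionTorus 2 L) (2 * N2) 0)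
    (hφ1 : star φ ⬝ᵥ φ = 1) :
    ε * (L : ℝ) ^ 2 * (Y₂ - Y₁) / (1 + Y₂ ^ 2) ≤
      Real.pi * (((star φ ⬝ᵥ hubbardTorus 2 L 1 U *ᵥ φ).re -
          (hubbardTorus 2 L 1 U).minEnergyOn (szSector (Λ := FermionTorus 2 L) (2 * N2) 0)) +
        (1 : ℝ) / (L : ℝ) ^ 2 *
          (star φ ⬝ᵥ ((pairField dWaveFormFactor L)ᴴ * pairField dWaveFormFactor L) *ᵥ φ).re) := by
  -- notation (as in `kkFloor_everyGS_floor`)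
  set H : Matrix (Finset (Orb (FermionTorus 2 L))) (Finset (Orb (FermionTorus 2 L))) ℂ :=
    hubbardTorus 2 L 1 U with hH
  set P : Matrix (Finset (Orb (FermionTorus 2 L))) (Finset (Orb (FermionTorus 2 L))) ℂ :=
    (pairField dWaveFormFactor L)ᴴ * pairField dWaveFormFactor L with hP
  set B : Matrix (Finset (Orb (FermionTorus 2 L))) (Finset (Orb (FermionTorus 2 L))) ℂ :=
    ((((1 : ℝ) / (L : ℝ) ^ 2 : ℝ) : ℂ)) • P with hB
  set V : Submodule ℂ (Fock (Orb (FermionTorus 2 L))) :=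
    szSector (Λ := FermionTorus 2 L) (2 * N2) 0 with hV
  set E : ℝ := H.minEnergyOn V with hE
  have hL : (0 : ℝ) < (L : ℝ) := Nat.cast_pos.2 (Nat.pos_of_ne_zero (NeZero.ne L))
  have hL2 : (0 : ℝ) < (L : ℝ) ^ 2 := by positivity
  -- hypotheses of the floor
  have hHh : H.IsHermitian := hubbardTorus_isHermitian (hamiltonian_isHermitian_and_commute_holds _) 1 U
  have hPpsd : P.PosSemidef := pairField_conjTranspose_mul_self_posSemidef dWaveFormFactor L
  have hBh : B.IsHermitian :=
    hPpsd.isHermitian.smul (by rw [isSelfAdjoint_iff, Complex.star_def, Complex.conj_ofReal])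
  have hPre : ∀ v : Fock (Orb (FermionTorus 2 L)), 0 ≤ (star v ⬝ᵥ P *ᵥ v).re := fun v =>
    expect_pairIntensity_nonneg L v
  have hBre : ∀ v : Fock (Orb (FermionTorus 2 L)),
      (star v ⬝ᵥ B *ᵥ v).re = (1 : ℝ) / (L : ℝ) ^ 2 * (star v ⬝ᵥ P *ᵥ v).re := by
    intro v
    rw [hB, smul_mulVec, dotProduct_smul, smul_eq_mul, Complex.re_ofReal_mul]
  have hBnonneg : ∀ v : Fock (Orb (FermionTorus 2 L)), 0 ≤ (star v ⬝ᵥ B *ᵥ v).re := by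
    intro v
    rw [hBre]
    exact mul_nonneg (by positivity) (hPre v)
  have hHinv : ∀ v ∈ V, H *ᵥ v ∈ V := fun v hv =>
    Summit.HubbardSuperconductivity.HubbardSuperconductivity.Theorems.hubbardTorus_mulVec_mem_szSector
      2 L 1 U N2 hv
  have hBinv : ∀ v ∈ V, B *ᵥ v ∈ V := by
    intro v hv
    rw [hB, smul_mulVec]
    exact V.smul_mem _
      (Summit.HubbardSuperconductivity.HubbardSuperconductivity.Theorems.BirGroundStateAverageLRO.Softmin.pairPenalty_mulVec_mem_szSector
        L N2 hv)
  have hEle : ∀ v ∈ V, star v ⬝ᵥ v = 1 → E ≤ (star v ⬝ᵥ H *ᵥ v).re := fun v hv hv1 =>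
    minEnergyOn_le_rayleigh_of_mem hHh V hv hv1
  have hEig : ∀ y ∈ Set.Icc Y₁ Y₂, ∀ v ∈ V, v ≠ 0 → ∀ lam : ℂ,
      (H + (Complex.I * (y : ℂ)) • B) *ᵥ v = lam • v → E + (fun _ : ℝ => ε * (L : ℝ) ^ 2) y ≤ lam.re :=
    fun y hy v hv hv0 lam hlam => hband y hy v hv hv0 lam hlam
  -- the finite-height floor at `x = 1`
  have key := hF (Finset (Orb (FermionTorus 2 L))) H B V E 1 (Set.Icc Y₁ Y₂)
    (fun _ => ε * (L : ℝ) ^ 2) hHh hBh hBnonneg hHinv hBinv hEle one_pos hEig φ hφV hφ1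
  -- lower bound of the left-hand side on the band: `1/(1+y²) ≥ 1/(1+Y₂²)`
  have hY₂ : 0 < Y₂ := hY₁.trans hY₁₂
  have hconst : ∀ y ∈ Set.Icc Y₁ Y₂,
      ENNReal.ofReal (ε * (L : ℝ) ^ 2 * (1 / (1 + Y₂ ^ 2))) ≤
        ENNReal.ofReal ((fun _ : ℝ => ε * (L : ℝ) ^ 2) y * ((1 : ℝ) / ((1 : ℝ) ^ 2 + y ^ 2))) := by
    intro y hy
    have hy0 : 0 < y := hY₁.trans_le hy.1
    refine ENNReal.ofReal_le_ofReal (mul_le_mul_of_nonneg_left ?_ (by positivity))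
    rw [one_pow]
    refine div_le_div_of_nonneg_left zero_le_one (by positivity) ?_
    nlinarith [pow_le_pow_left₀ hy0.le hy.2 2]
  have hlow : ENNReal.ofReal (ε * (L : ℝ) ^ 2 * (1 / (1 + Y₂ ^ 2)) * (Y₂ - Y₁)) ≤
      ∫⁻ y in Set.Icc Y₁ Y₂,
        ENNReal.ofReal ((fun _ : ℝ => ε * (L : ℝ) ^ 2) y * ((1 : ℝ) / ((1 : ℝ) ^ 2 + y ^ 2))) := by
    calc ENNReal.ofReal (ε * (L : ℝ) ^ 2 * (1 / (1 + Y₂ ^ 2)) * (Y₂ - Y₁))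
        = ENNReal.ofReal (ε * (L : ℝ) ^ 2 * (1 / (1 + Y₂ ^ 2))) * volume (Set.Icc Y₁ Y₂) := by
          rw [Real.volume_Icc, ENNReal.ofReal_mul (by positivity)]
      _ = ∫⁻ _ in Set.Icc Y₁ Y₂, ENNReal.ofReal (ε * (L : ℝ) ^ 2 * (1 / (1 + Y₂ ^ 2))) := by
          rw [setLIntegral_const]
      _ ≤ ∫⁻ y in Set.Icc Y₁ Y₂,
            ENNReal.ofReal ((fun _ : ℝ => ε * (L : ℝ) ^ 2) y * ((1 : ℝ) / ((1 : ℝ) ^ 2 + y ^ 2))) :=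
          setLIntegral_mono' measurableSet_Icc fun y hy => hconst y hy
  have hfin := hlow.trans key
  have hrhs : 0 ≤ Real.pi * (((star φ ⬝ᵥ H *ᵥ φ).re - E) + 1 * (star φ ⬝ᵥ B *ᵥ φ).re) := by
    refine mul_nonneg Real.pi_pos.le (add_nonneg ?_ ?_)
    · linarith [hEle φ hφV hφ1]
    · rw [one_mul]; exact hBnonneg φ
  rw [ENNReal.ofReal_le_ofReal_iff hrhs, hBre, one_mul] at hfin
  -- `hfin : ε L² (1/(1+Y₂²)) (Y₂ - Y₁) ≤ π ((⟨H⟩ - E) + (1/L²) ⟨P⟩)`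
  have heq : ε * (L : ℝ) ^ 2 * (1 / (1 + Y₂ ^ 2)) * (Y₂ - Y₁) =
      ε * (L : ℝ) ^ 2 * (Y₂ - Y₁) / (1 + Y₂ ^ 2) := by
    field_simp
  rw [heq] at hfin
  exact hfin

/-- **¬ KkBandLift from N1 and the thermal-shell witness** (the refutation, kernel-checked modulo
the two inputs): at the band's `(U, δ)` take `c = ε (Y₂ - Y₁) / (4π (1 + Y₂²))`, an even side
`L ≥ L₀, L₁`, and the witness `φ`; `lowEnergy_pairOrder_of_band` then reads
`4πc L² ≤ π (c L² + c L²)`. [folklore] -/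
theorem not_kkBandLift_of (hF : FiniteXFloor)
    (hW : ∀ U δ : ℝ, 0 < U → δ ∈ Set.Ioo (0 : ℝ) (1 / 2) → ThermalShellWitness U δ) :
    ¬ KkBandLift := by
  rintro ⟨U, hU, δ, hδ, ε, hε, Y₁, hY₁, Y₂, hY₁₂, L₀, hband⟩
  have hY₂ : 0 < Y₂ := hY₁.trans hY₁₂
  set c : ℝ := ε * (Y₂ - Y₁) / (4 * Real.pi * (1 + Y₂ ^ 2)) with hc
  have hcpos : 0 < c := by
    rw [hc]
    exact div_pos (mul_pos hε (sub_pos.2 hY₁₂)) (by positivity)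
  obtain ⟨L₁, hL₁⟩ := hW U δ hU hδ c hcpos
  -- an even side beyond both thresholds
  set L : ℕ := 2 * (max L₀ L₁ + 1) with hLdef
  haveI : NeZero L := ⟨by rw [hLdef]; omega⟩
  have hL₀L : L₀ ≤ L := by
    rw [hLdef]; have := le_max_left L₀ L₁; omega
  have hL₁L : L₁ ≤ L := by
    rw [hLdef]; have := le_max_right L₀ L₁; omega
  have hEven : Even L := ⟨max L₀ L₁ + 1, by rw [hLdef]; ring⟩
  have hLpos : (0 : ℝ) < (L : ℝ) := Nat.cast_pos.2 (Nat.pos_of_ne_zero (NeZero.ne L))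
  have hL2 : (0 : ℝ) < (L : ℝ) ^ 2 := by positivity
  obtain ⟨φ, hφV, hφ1, hφE, hφP⟩ := hL₁ L hL₁L
  have key := lowEnergy_pairOrder_of_band hF L U (⌊(1 - δ) * (L : ℝ) ^ 2 / 2⌋₊) hε hY₁ hY₁₂
    (hband L hL₀L hEven) hφV hφ1
  -- abbreviate the two expectations
  set eH : ℝ := (star φ ⬝ᵥ hubbardTorus 2 L 1 U *ᵥ φ).re -
      (hubbardTorus 2 L 1 U).minEnergyOn
        (szSector (Λ := FermionTorus 2 L) (2 * ⌊(1 - δ) * (L : ℝ) ^ 2 / 2⌋₊) 0) with heH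
  set eP : ℝ := (star φ ⬝ᵥ ((pairField dWaveFormFactor L)ᴴ * pairField dWaveFormFactor L) *ᵥ φ).re
    with heP
  have h1 : eH ≤ c * (L : ℝ) ^ 2 := by rw [heH]; linarith
  have h2 : (1 : ℝ) / (L : ℝ) ^ 2 * eP ≤ c * (L : ℝ) ^ 2 := by
    rw [div_mul_eq_mul_div, one_mul, div_le_iff₀ hL2]
    calc eP ≤ c * (L : ℝ) ^ 4 := hφP
      _ = c * (L : ℝ) ^ 2 * (L : ℝ) ^ 2 := by ring
  have h3 : Real.pi * (eH + (1 : ℝ) / (L : ℝ) ^ 2 * eP) ≤ Real.pi * (2 * c * (L : ℝ) ^ 2) := by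
    refine mul_le_mul_of_nonneg_left ?_ Real.pi_pos.le
    linarith
  have h4 : Real.pi * (2 * c * (L : ℝ) ^ 2) = ε * (L : ℝ) ^ 2 * (Y₂ - Y₁) / (1 + Y₂ ^ 2) / 2 := by
    rw [hc]
    field_simp
    ring
  have h5 : 0 < ε * (L : ℝ) ^ 2 * (Y₂ - Y₁) / (1 + Y₂ ^ 2) :=
    div_pos (mul_pos (mul_pos hε hL2) (sub_pos.2 hY₁₂)) (by positivity)
  have := key.trans h3
  rw [h4] at this
  linarith

/-- **The full skeleton**: N1 ∧ N3 ∧ N4 ⇒ ¬ KkBandLift (through the bookkeeping stub). -/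
theorem not_kkBandLift_of_stubs (hF : FiniteXFloor) (h3 : GibbsShellSelection)
    (h4 : SectorPairDecay) : ¬ KkBandLift :=
  not_kkBandLift_of hF fun U δ _ hδ => stub_thermalShellWitness_of h3 h4 U δ hδ

/-- Sanity: with the stubs discharged this closes the crux NEGATIVELY. -/
theorem not_kkBandLift : ¬ KkBandLift :=
  not_kkBandLift_of_stubs stub_finiteXFloor stub_gibbsShellSelection stub_sectorPairDecay

end Summit.HubbardSuperconductivity.HubbardSuperconductivity.Cruxes.KkBandLift.ThermalShell
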